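import Literature.MathematicalPhysics.QuantumFieldTheory.Balaban1983to89.B12EdgeTreeLength257

/-!
# `Balaban1983to89.B12ShortestEdgeTree257` — [Balaban1987RG1] p. 257, «the shortest TREE graphs formed by edges of
cubes in X»: SPANNING-TREE PRUNING of admissible edge graphs — a shortest admissible edge graph can be chosen to be a
TREE (its combinatorial graph of lattice vertices and unit edges is a tree), and `edgeLen X + 1` is the least number
of lattice vertices of an admissible edge graph (proved)

statement-level skeleton of published theorems with citation tags; proofs where landed; nothing here is a claim about
the Yang–Mills mass gap

CITATION HEADER (lean-in-tree rule 2026-08-18).  Source under audit: T. Bałaban, *Renormalization group approach to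
lattice gauge field theories. I.*, Commun. Math. Phys. **109**, 249–301 (1987) [Balaban1987RG1] (cell paper B12 = "[I]";
held `paper:balaban1987-cmp109-rg-i-small-field`, journal page = PDF page + 248; p. 257 = PDF p. 9).  Satellite of
`…Balaban1983to89.B12EdgeTreeLength257` (edge graphs `EAdmissible X E`, `nedges`, `verts`, `edgeLen`, the combinatorial
graph `cgraph E` on the lattice endpoints, `cgraph_connected`, `card_verts_le_nedges_add_one`), whose HONEST SCOPE (b)
reads: «for edge graphs a spanning tree of a connected edge graph has no more edges, so `edgeLen` is also the least
edge number of an admissible edge TREE — the pruning itself is not formalised»; the present file formalises that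
pruning.  Nothing existing is modified.  Cell records: ROWS-B12 (r09) row B12.Note@257; `TreeLength` convention (ii)
(connected unions instead of trees).  Unit `lit-balaban-r09` gen 15 (reader/typer r09, display owner of B12).

WHAT THE PAPER PRINTS (p. 257, verbatim).  *"Consider a class of tree graphs contained in X and intersecting all the
cubes in X. A length of a shortest graph in this class … is the linear size of X … there are also the shortest tree
graphs formed by edges of cubes in X, hence an equivalent definition can be formulated, based on such graphs only."*

WHAT IS FORMALISED HERE (kernel-checked).
* §1 — the carrier of a list of lattice pairs (`mem_carrier_toSegs`).
* §2 — SPANNING-TREE PRUNING `exists_tree_pruning`: for every admissible edge graph E₀ for X there is an admissible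
  edge graph E for X made of the vertex loops of E₀ and of members of E₀ realising the edges of a spanning tree T of
  the (connected, `cgraph_connected`) combinatorial graph of E₀ (Mathlib `SimpleGraph.Connected.exists_isTree_le`),
  one member per tree edge; `verts E = verts E₀`, `nedges E + 1 = |verts E₀|` (Mathlib `IsTree.card_edgeFinset`), and
  `cgraph E` is a TREE (Mathlib `isTree_iff_connected_and_card` with `card_edgeSet_cgraph_le`).  Admissibility of E:
  every cube of X contains a lattice vertex of E₀ (`exists_vertex_mem_carrier`), kept as a loop; connectedness of
  the carrier by walk induction along T (consecutive tree edges are realised by members sharing a lattice vertex;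
  Mathlib `IsConnected.iUnion_of_reflTransGen`).
* §3 — consequences: `edgeLen_add_one_le_card_verts` (every admissible edge graph has ≥ edgeLen X + 1 lattice
  vertices), `exists_shortest_edgeTree` (a shortest admissible edge graph which is a TREE with edgeLen X unit edges and
  edgeLen X + 1 lattice vertices exists whenever some admissible edge graph exists), `card_verts_of_nedges_eq_edgeLen`
  (EVERY shortest admissible edge graph has exactly edgeLen X + 1 lattice vertices), `isTree_of_nedges_eq_edgeLen`
  (every shortest one listing each unit edge once is a tree), `exists_shortest_edgeTree_of_faceConnected`
  (localization domains, with `B12EdgeTreeLength257.exists_eAdmissible`/`edgeLen_add_one_le_card`).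

HONEST SCOPE.  (a) «Tree» is the combinatorial notion (Mathlib `SimpleGraph.IsTree` of `cgraph E`: the simple graph
on the lattice endpoints of E whose edges are the listed unit edges); the carrier of such an E is the geometric
realisation of that tree.  The continuum class of p. 257 («tree graphs contained in X») is still taken with
`TreeLength` convention (ii) (connected finite unions of segments); the pruning of a shortest CONTINUUM graph to a
tree is not addressed here.  (b) The statement proved is exactly what `B12EdgeTreeLength257` HONEST SCOPE (b)
announced without proof; no printed claim is adjudicated.  (c) Route ours (the print gives none).  Value =
kernel-checked bookkeeping on a printed notion, NOT summit progress.
-/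

namespace Literature.MathematicalPhysics.QuantumFieldTheory.Balaban1983to89.B12ShortestEdgeTree257

noncomputable section

open Literature.MathematicalPhysics.QuantumFieldTheory.Balaban1983to89
open Literature.MathematicalPhysics.QuantumFieldTheory.Balaban1983to89.B13ScaleTransfer
open Literature.MathematicalPhysics.QuantumFieldTheory.Balaban1983to89.TreeLength
open Literature.MathematicalPhysics.QuantumFieldTheory.Balaban1983to89.B12EdgeTreeLength257
open _root_.Topology Relation

variable {d : ℕ}

/-! ## §1. The carrier of a list of lattice pairs -/

/-- Carrier of the segments of a list of lattice pairs. [cite: Balaban1987RG1, p.257 (linear size d_j, edges of cubes)] -/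
theorem mem_carrier_toSegs {E : List (Pt d × Pt d)} {z : RPt d} :
    z ∈ carrier (toSegs E) ↔ ∃ e ∈ E, z ∈ segment ℝ (corner e.1) (corner e.2) := by
  rw [mem_carrier]
  unfold toSegs
  constructor
  · rintro ⟨s, hs, hz⟩
    obtain ⟨e, he, rfl⟩ := List.mem_map.1 hs
    exact ⟨e, he, hz⟩
  · rintro ⟨e, he, hz⟩
    exact ⟨seg e, List.mem_map.2 ⟨e, he, rfl⟩, hz⟩

/-! ## §2. Realising a spanning tree of the combinatorial graph by members of the list -/

/-- Every edge of a subgraph T of the combinatorial graph of E₀ is realised by a member of E₀ with distinct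
endpoints. [cite: Balaban1987RG1, p.257 (linear size d_j, edges of cubes)] -/
theorem exists_member_of_mem_edgeSet {E₀ : List (Pt d × Pt d)} {T : SimpleGraph (verts E₀)} (hle : T ≤ cgraph E₀)
    {t : Sym2 (verts E₀)} (ht : t ∈ T.edgeSet) :
    ∃ e ∈ E₀, e.1 ≠ e.2 ∧ Sym2.map Subtype.val t = s(e.1, e.2) := by
  induction t using Sym2.ind with
  | h a b =>
    rw [SimpleGraph.mem_edgeSet] at ht
    have hab : (cgraph E₀).Adj a b := hle ht
    rw [cgraph, SimpleGraph.fromRel_adj] at hab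
    obtain ⟨hne, h | h⟩ := hab
    · exact ⟨_, h, fun heq => hne (Subtype.ext heq), by rw [Sym2.map_mk]⟩
    · exact ⟨_, h, fun heq => hne (Subtype.ext heq).symm, by rw [Sym2.map_mk, Sym2.eq_swap]⟩

/-- SPANNING-TREE PRUNING: for every admissible edge graph E₀ there is an admissible edge graph E with the same
lattice vertices, made of vertex loops and of members of E₀ realising the edges of a spanning tree of the
combinatorial graph of E₀ (Mathlib `SimpleGraph.Connected.exists_isTree_le`); it has |verts E₀| − 1 unit edges and
its combinatorial graph is a TREE. [cite: Balaban1987RG1, p.257 (linear size d_j, edges of cubes)] -/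
theorem exists_tree_pruning {X : Finset (Pt d)} {E₀ : List (Pt d × Pt d)} (hE₀ : EAdmissible X E₀) :
    ∃ E, EAdmissible X E ∧ (∀ e ∈ E, e ∈ E₀ ∨ e.1 = e.2) ∧ verts E = verts E₀ ∧
      nedges E + 1 = (verts E₀).card ∧ (cgraph E).IsTree := by
  classical
  obtain ⟨T, hle, hT⟩ := (cgraph_connected hE₀).exists_isTree_le
  have hreal : ∀ t ∈ T.edgeFinset, ∃ e ∈ E₀, e.1 ≠ e.2 ∧ Sym2.map Subtype.val t = s(e.1, e.2) :=
    fun t ht => exists_member_of_mem_edgeSet hle (SimpleGraph.mem_edgeFinset.1 ht)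
  choose f hfmem hfne hfmap using hreal
  set ET : List (Pt d × Pt d) := T.edgeFinset.attach.toList.map fun t => f t.1 t.2 with hET
  have hmemET : ∀ {e}, e ∈ ET ↔ ∃ (t : Sym2 (verts E₀)) (ht : t ∈ T.edgeFinset), e = f t ht := by
    intro e
    rw [hET, List.mem_map]
    constructor
    · rintro ⟨⟨t, ht⟩, -, rfl⟩
      exact ⟨t, ht, rfl⟩
    · rintro ⟨t, ht, rfl⟩
      exact ⟨⟨t, ht⟩, Finset.mem_toList.2 (Finset.mem_attach _ _), rfl⟩
  -- the vertex loops (v, v), v ∈ verts E₀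
  set L : List (Pt d × Pt d) := (verts E₀).toList.map fun v => (v, v) with hL
  have hmemL : ∀ {e}, e ∈ L ↔ ∃ v ∈ verts E₀, e = (v, v) := by
    intro e
    rw [hL, List.mem_map]
    constructor
    · rintro ⟨v, hv, rfl⟩
      exact ⟨v, Finset.mem_toList.1 hv, rfl⟩
    · rintro ⟨v, hv, rfl⟩
      exact ⟨v, Finset.mem_toList.2 hv, rfl⟩
  have hnL : nedges L = 0 := by
    unfold nedges
    rw [List.length_eq_zero_iff, List.filter_eq_nil_iff]
    intro e he
    obtain ⟨v, -, rfl⟩ := hmemL.1 he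
    simp
  set E : List (Pt d × Pt d) := L ++ ET with hE
  have hmemE : ∀ {e}, e ∈ E ↔ (∃ v ∈ verts E₀, e = (v, v)) ∨ ∃ (t : Sym2 (verts E₀)) (ht : t ∈ T.edgeFinset),
      e = f t ht := by
    intro e
    rw [hE, List.mem_append, hmemL, hmemET]
  -- endpoints of members of E are lattice vertices of E₀
  have hends : ∀ e ∈ E, e.1 ∈ verts E₀ ∧ e.2 ∈ verts E₀ := by
    intro e he
    rcases hmemE.1 he with ⟨v, hv, rfl⟩ | ⟨t, ht, rfl⟩
    · exact ⟨hv, hv⟩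
    · exact ⟨fst_mem_verts (hfmem t ht), snd_mem_verts (hfmem t ht)⟩
  have hverts : verts E = verts E₀ := by
    ext v
    rw [mem_verts]
    constructor
    · rintro ⟨e, he, h | h⟩
      · rw [h]; exact (hends e he).1
      · rw [h]; exact (hends e he).2
    · intro hv
      exact ⟨(v, v), hmemE.2 (Or.inl ⟨v, hv, rfl⟩), Or.inl rfl⟩
  -- a T-adjacency is realised by a member of E containing both endpoints
  have hadjE : ∀ {p q : verts E₀}, T.Adj p q → ∃ m ∈ E,
      ((p : Pt d) = m.1 ∨ (p : Pt d) = m.2) ∧ ((q : Pt d) = m.1 ∨ (q : Pt d) = m.2) := by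
    intro p q hpq
    have ht : s(p, q) ∈ T.edgeFinset := SimpleGraph.mem_edgeFinset.2 hpq
    refine ⟨f _ ht, hmemE.2 (Or.inr ⟨_, ht, rfl⟩), ?_⟩
    have h := hfmap _ ht
    rw [Sym2.map_mk, Sym2.eq_iff] at h
    rcases h with ⟨h1, h2⟩ | ⟨h1, h2⟩
    · exact ⟨Or.inl h1, Or.inr h2⟩
    · exact ⟨Or.inr h1, Or.inl h2⟩
  -- carrier of E inside carrier of E₀
  have hsub : carrier (toSegs E) ⊆ carrier (toSegs E₀) := by
    intro z hz
    obtain ⟨e, he, hz⟩ := mem_carrier_toSegs.1 hz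
    rcases hmemE.1 he with ⟨v, hv, rfl⟩ | ⟨t, ht, rfl⟩
    · simp only [segment_same, Set.mem_singleton_iff] at hz
      rw [hz]
      exact corner_mem_carrier_of_mem_verts hv
    · exact mem_carrier_toSegs.2 ⟨_, hfmem t ht, hz⟩
  -- connectedness of the carrier of E
  have hX : X.Nonempty := hE₀.admissible.finset_nonempty
  obtain ⟨x₀, hx₀⟩ := hX
  obtain ⟨u₀, hu₀, -, -⟩ := exists_vertex_mem_carrier hE₀ hx₀
  have hloop : ∀ {v}, v ∈ verts E₀ → (v, v) ∈ E := fun hv => hmemE.2 (Or.inl ⟨_, hv, rfl⟩)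
  haveI : Nonempty {e // e ∈ E} := ⟨⟨(u₀, u₀), hloop hu₀⟩⟩
  have link : ∀ {u v : verts E₀} (w : T.Walk u v) (i : {e // e ∈ E}),
      ((u : Pt d) = i.1.1 ∨ (u : Pt d) = i.1.2) → ∃ j : {e // e ∈ E}, ((v : Pt d) = j.1.1 ∨ (v : Pt d) = j.1.2) ∧
        ReflTransGen (fun i j : {e // e ∈ E} =>
          (segment ℝ (corner i.1.1) (corner i.1.2) ∩ segment ℝ (corner j.1.1) (corner j.1.2)).Nonempty) i j := by
    intro u v w
    induction w with
    | nil => exact fun i hi => ⟨i, hi, ReflTransGen.refl⟩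
    | @cons a b c hab w ih =>
        intro i hi
        obtain ⟨m, hm, ha, hb⟩ := hadjE hab
        obtain ⟨j, hj, hmj⟩ := ih ⟨m, hm⟩ hb
        refine ⟨j, hj, ReflTransGen.head ?_ hmj⟩
        exact ⟨corner a, corner_mem_segment_of_endpoint hi, corner_mem_segment_of_endpoint ha⟩
  have hconn : IsConnected (carrier (toSegs E)) := by
    have hU : (⋃ i : {e // e ∈ E}, segment ℝ (corner i.1.1) (corner i.1.2)) = carrier (toSegs E) := by
      ext z
      rw [Set.mem_iUnion, mem_carrier_toSegs]
      constructor
      · rintro ⟨⟨e, he⟩, hz⟩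
        exact ⟨e, he, hz⟩
      · rintro ⟨e, he, hz⟩
        exact ⟨⟨e, he⟩, hz⟩
    rw [← hU]
    refine IsConnected.iUnion_of_reflTransGen
      (fun i => (convex_segment _ _).isConnected ⟨_, left_mem_segment ℝ _ _⟩) fun i j => ?_
    have hr : T.Reachable ⟨i.1.1, (hends i.1 i.2).1⟩ ⟨j.1.1, (hends j.1 j.2).1⟩ := hT.connected.preconnected _ _
    obtain ⟨w⟩ := hr
    obtain ⟨j', hj', hij'⟩ := link w i (Or.inl rfl)
    refine hij'.tail ⟨corner j.1.1, corner_mem_segment_of_endpoint hj', left_mem_segment ℝ _ _⟩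
  have hEadm : EAdmissible X E := by
    refine ⟨?_, ?_, ⟨hconn, hsub.trans hE₀.admissible.subset, ?_⟩⟩
    · intro e he
      rcases hmemE.1 he with ⟨v, -, rfl⟩ | ⟨t, ht, rfl⟩
      · exact Or.inl rfl
      · exact hE₀.lattice _ (hfmem t ht)
    · intro e he
      rcases hmemE.1 he with ⟨v, hv, rfl⟩ | ⟨t, ht, rfl⟩
      · obtain ⟨e', he', hv'⟩ := mem_verts.1 hv
        obtain ⟨x, hx, h1, h2⟩ := hE₀.ofCube e' he'
        rcases hv' with rfl | rfl
        · exact ⟨x, hx, h1, h1⟩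
        · exact ⟨x, hx, h2, h2⟩
      · exact hE₀.ofCube _ (hfmem t ht)
    · intro x hx
      obtain ⟨u, hu, hxu, -⟩ := exists_vertex_mem_carrier hE₀ hx
      exact ⟨corner u, mem_carrier_toSegs.2 ⟨(u, u), hloop hu, left_mem_segment ℝ _ _⟩,
        corner_mem_cube_of_isVertex hxu⟩
  -- counting
  have hnET : nedges ET = T.edgeFinset.card := by
    unfold nedges
    rw [List.filter_eq_self.2, hET, List.length_map, Finset.length_toList, Finset.card_attach]
    intro e he
    obtain ⟨t, ht, rfl⟩ := hmemET.1 he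
    simpa using hfne t ht
  have hnE : nedges E = T.edgeFinset.card := by
    have h : nedges E = nedges L + nedges ET := by
      unfold nedges
      rw [hE, List.filter_append, List.length_append]
    rw [h, hnL, zero_add, hnET]
  have hcardT : T.edgeFinset.card + 1 = (verts E₀).card := by
    rw [hT.card_edgeFinset, Fintype.card_coe]
  have hcount : nedges E + 1 = (verts E₀).card := by rw [hnE, hcardT]
  refine ⟨E, hEadm, ?_, hverts, hcount, ?_⟩
  · intro e he
    rcases hmemE.1 he with ⟨v, -, rfl⟩ | ⟨t, ht, rfl⟩
    · exact Or.inr rfl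
    · exact Or.inl (hfmem t ht)
  · rw [SimpleGraph.isTree_iff_connected_and_card]
    refine ⟨cgraph_connected hEadm, ?_⟩
    have h1 := card_edgeSet_cgraph_le E
    have h2 := (cgraph_connected hEadm).card_vert_le_card_edgeSet_add_one
    have h3 : Nat.card (verts E) = (verts E₀).card := by
      rw [Nat.card_eq_fintype_card, Fintype.card_coe, hverts]
    omega

/-! ## §3. The shortest edge graphs are trees; edgeLen X + 1 = the least number of lattice vertices -/

/-- VERTEX BOUND: every admissible edge graph has at least edgeLen X + 1 lattice vertices (its spanning-tree pruning
is admissible with |verts| − 1 unit edges). [cite: Balaban1987RG1, p.257 (linear size d_j, edges of cubes)] -/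
theorem edgeLen_add_one_le_card_verts {X : Finset (Pt d)} {E : List (Pt d × Pt d)} (hE : EAdmissible X E) :
    edgeLen X + 1 ≤ (verts E).card := by
  obtain ⟨E', hE', -, -, hcount, -⟩ := exists_tree_pruning hE
  have := edgeLen_le_nedges hE'
  omega

/-- «THE SHORTEST TREE GRAPHS FORMED BY EDGES OF CUBES» ARE TREES: a shortest admissible edge graph can be chosen
whose combinatorial graph (lattice vertices, unit edges) is a TREE, with exactly edgeLen X unit edges and
edgeLen X + 1 lattice vertices — the pruning to tree graphs left unformalised in `B12EdgeTreeLength257` (HONEST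
SCOPE (b)) for the edge class. [cite: Balaban1987RG1, p.257 (linear size d_j, edges of cubes)] -/
theorem exists_shortest_edgeTree {X : Finset (Pt d)} (hne : ∃ E, EAdmissible X E) :
    ∃ E, EAdmissible X E ∧ nedges E = edgeLen X ∧ (verts E).card = edgeLen X + 1 ∧ (cgraph E).IsTree := by
  obtain ⟨E₀, hE₀, hn₀⟩ := exists_eAdmissible_nedges_eq hne
  obtain ⟨E, hE, -, hverts, hcount, htree⟩ := exists_tree_pruning hE₀
  have h1 := edgeLen_le_nedges hE
  have h2 := card_verts_le_nedges_add_one hE₀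
  refine ⟨E, hE, by omega, ?_, htree⟩
  rw [hverts]
  omega

/-- A SHORTEST ADMISSIBLE EDGE GRAPH HAS edgeLen X + 1 LATTICE VERTICES (no fewer by the vertex bound, no more by
the vertex–edge count of connected graphs). [cite: Balaban1987RG1, p.257 (linear size d_j, edges of cubes)] -/
theorem card_verts_of_nedges_eq_edgeLen {X : Finset (Pt d)} {E : List (Pt d × Pt d)} (hE : EAdmissible X E)
    (hmin : nedges E = edgeLen X) : (verts E).card = edgeLen X + 1 := by
  have h1 := edgeLen_add_one_le_card_verts hE
  have h2 := card_verts_le_nedges_add_one hE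
  omega

/-- EVERY shortest admissible edge graph WITHOUT REPEATED unit edges is a tree: if nedges E = edgeLen X and the
combinatorial graph has nedges E edges (each unit edge listed once), then it is a tree. [cite: Balaban1987RG1, p.257 (linear size d_j, edges of cubes)] -/
theorem isTree_of_nedges_eq_edgeLen {X : Finset (Pt d)} {E : List (Pt d × Pt d)} (hE : EAdmissible X E)
    (hmin : nedges E = edgeLen X) (hsimple : Nat.card (cgraph E).edgeSet = nedges E) : (cgraph E).IsTree := by
  classical
  rw [SimpleGraph.isTree_iff_connected_and_card]
  refine ⟨cgraph_connected hE, ?_⟩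
  rw [hsimple, Nat.card_eq_fintype_card, Fintype.card_coe, card_verts_of_nedges_eq_edgeLen hE hmin, hmin]

/-- For every LOCALIZATION DOMAIN: a shortest tree graph formed by edges of cubes exists and is a tree with
edgeLen Y + 1 ≤ |Y| lattice vertices. [cite: Balaban1987RG1, p.257 (linear size d_j, edges of cubes)] -/
theorem exists_shortest_edgeTree_of_faceConnected {Y : Finset (Pt d)} (hY : Y.Nonempty) (hc : FaceConnected Y) :
    ∃ E, EAdmissible Y E ∧ nedges E = edgeLen Y ∧ (verts E).card = edgeLen Y + 1 ∧ (cgraph E).IsTree ∧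
      (verts E).card ≤ Y.card := by
  obtain ⟨E₀, hE₀, -⟩ := exists_eAdmissible hY hc
  obtain ⟨E, hE, hn, hv, ht⟩ := exists_shortest_edgeTree ⟨E₀, hE₀⟩
  refine ⟨E, hE, hn, hv, ht, ?_⟩
  rw [hv]
  exact edgeLen_add_one_le_card hY hc

end

end Literature.MathematicalPhysics.QuantumFieldTheory.Balaban1983to89.B12ShortestEdgeTree257
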